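import Summits.BirchSwinnertonDyer.BirchSwinnertonDyer.Theorems.TwoAdicConverseTwoTorsionNFPointCountModFour
import Summits.BirchSwinnertonDyer.BirchSwinnertonDyer.Theorems.TwoAdicConverseTwoTorsionIsogenyPairs
import Literature.NumberTheory.EllipticCurves.VariableChangePoints
import Literature.NumberTheory.EllipticCurves.ComplexMultiplicationDeuringReduction
import Literature.NumberTheory.EllipticCurves.Greenberg1999.TwoTorsionOddIsogenyDualProofs
import HarnessLib

/-!
# Route `TwoAdicConverse` (rung S3), crux `OrdLambdaHalfAtTwo` (item 19556), card `mod-four-redei-layer-two` —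
# lemma K0 `ModFourTraceOfOneTwoTorsionPoint`: the trace of Frobenius mod `4` from ONE rational point of order `2`

Cell `bsd-2adic`, seat `bsd-2adic-conv-1` (GEN 21). THEOREMS ONLY — no named fact, no definition, nothing conditional.
HONEST FRAMING: the elementary lemma K0 of the crux idea `Cruxes/OrdLambdaHalfAtTwo/Ideas/mod-four-redei-layer-two.md`
(«First lemma … halving criterion in `Ẽ(𝔽_ℓ)` — M-sized»; verified there on 10 602 (curve, `ℓ`) pairs), SALVAGED by the pen
as a lemma toward the analytic stub of line `gv-mixed-descent-two` (PEN-PICK-19556-r1 §1(c)); K1–K3 of that card (modular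
symbols mod `4`) are NOT touched. Nothing about `λ`-invariants or BSD is claimed; items 19556 (`OrdLambdaHalfAtTwo`) and
19218 (`GoodOrdinaryRankZeroTwoConverse`) stay OPEN; BSD is not proved by any of this. PARTITION (D-0054): none — RANK axis (S3).

**Statement (K0).** Let `W/ℚ` be globally minimal with a rational point `P = (x, y)` of order `2`
(`HasRationalTwoTorsionX W x`; then `m = 4x ∈ ℤ`, `exists_int_eq_four_mul_of_hasRationalTwoTorsionX`), `b₂, b₄ ∈ ℤ` the
invariants of the minimal model, `Δ` its minimal discriminant, and `ℓ` an ODD prime of GOOD reduction; put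
`B = 3m² + 2b₂m + 8b₄` (`= 16·B'`, `B' = 3x² + (b₂/2)x + b₄/2` the coefficient of the centred model `y² = X(X² + A'X + B')`,
square class of the discriminant of `E' = E/⟨P⟩`). Then
* `four_dvd_reductionPointCount_iff_of_hasRationalTwoTorsionX`: **`4 ∣ #W̃(𝔽_ℓ) ⟺ (B/ℓ) = 1 ∨ (Δ/ℓ) = 1`**;
* `four_dvd_succ_sub_frobeniusTrace_iff_of_hasRationalTwoTorsionX`: the same for `4 ∣ ℓ + 1 - a_ℓ` — i.e. the Rédei-type
  congruence **`a_ℓ ≡ ℓ + 1 - 2·e_B(ℓ)·e_Δ(ℓ) (mod 4)`**, `e_c(ℓ) = [c non-square mod ℓ]`, STRICTLY REFINING the mod-`4`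
  Eisenstein congruence `eisensteinCongruenceModFour` of the full-`2`-torsion case (`Δ` a square);
* `four_dvd_pred_sub_frobeniusTrace_of_not_isSquare`: the doubly-inert case `a_ℓ ≡ ℓ - 1 (mod 4)`;
* `modFourTraceOfOneTwoTorsionPoint`: the card's rational currency (integer representatives `Bz`, `dz` prime to `ℓ` of the
  square classes of `B'` and `d' = A'² - 4B'`);
* `four_dvd_succ_sub_frobeniusTrace_iff_of_twoTorsionPair`: the CANONICAL form on a `ℤ/2`-linked pair of minimal models
  (`C • W` a two-torsion normal form, `C' • W' = (C • W).twoIsogenyCodomain`, the frame of the cell's pair calculus):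
  **`a_ℓ ≡ ℓ + 1 (mod 4) ⟺ Δ_{E'}` or `Δ_E` is a square mod `ℓ`**.

**Proof.** `exists_twoTorsionNF_reduction`: reduce the integral model mod `ℓ` (`reductionModPrime`, elliptic since
`ℓ ∤ Δ`), read `P̃ = (m/4, n/8)` on it (`n = 8y = -(a₁m + 4a₃)`; the curve equation becomes an INTEGER identity, so no
`Rat.cast`), and move `P̃` to the origin by the change of variables `(1, x̃, -ã₁/2, ỹ)` (tree `VariableChange.pointEquiv` /
`natCard_point_smul` preserve `#`): the result is `V : y² = x³ + ax² + bx` with `16b = B`, `4a = b₂ + 3m`, `Δ(V) = Δ`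
(mod `ℓ`); then Part 1's `four_dvd_natCard_point_iff_isSquare` and `16 = 4²`, `Δ(V) = (4b)²·(a² - 4b)`.

References: A. W. Knapp, *Elliptic Curves* (1992), Thm. 4.2, Thm. 5.1(b) [Knapp1993]; J. H. Silverman, *AEC*, GTM 106
(2009), III.1 Table 3.1, III.4 Example 4.5, VII.2, X.4.9, V.2.3.1 [SilvermanAEC2009]; R. Greenberg, LNM 1716 (1999), §5.
-/

set_option linter.dupNamespace false
set_option autoImplicit false

noncomputable section

open scoped Classical
open WeierstrassCurve Literature.NumberTheory.EllipticCurves Literature.NumberTheory.EllipticCurves.Greenberg1999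

namespace Summit.BirchSwinnertonDyer.BirchSwinnertonDyer.Theorems.TwoAdicTwistConverse

/-! ## §1. Transport to a globally minimal curve over `ℚ` with one rational point of order `2` -/

section Transport
variable (W : WeierstrassCurve ℚ) [W.IsElliptic] [W.IsGloballyMinimal]

omit [W.IsElliptic] in
/-- **The reduction modulo an odd good prime `ℓ` in two-torsion normal form.** For a globally
minimal `W/ℚ` with a rational point `P = (x, y)` of order `2` (`4x = m ∈ ℤ`) and an odd prime `ℓ` of
good reduction, the reduced curve `W̃/𝔽_ℓ` is isomorphic over `𝔽_ℓ` (translate `P̃` to the origin and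
complete the square in `y`: the change of variables `(1, x̃, -ã₁/2, ỹ)`) to an elliptic curve
`V : y² = x³ + ax² + bx` with `#V(𝔽_ℓ) = #W̃(𝔽_ℓ)`, `16b = 3m² + 2b₂m + 8b₄`, `4a = b₂ + 3m` and
`Δ(V) = Δ_W (mod ℓ)`. Silverman, *AEC*, III.1 (Table 3.1), VII.2; X.4.9 for the normal form.
[cite: SilvermanAEC2009, III.1 and X.4.9] -/
theorem exists_twoTorsionNF_reduction (ℓ : ℕ) [Fact ℓ.Prime] (hℓ : ℓ ≠ 2)
    (hgood : W.HasGoodReductionAtPrime ℓ) {x : ℚ} (hx : HasRationalTwoTorsionX W x) {m : ℤ}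
    (hm : (m : ℚ) = 4 * x) :
    ∃ (V : WeierstrassCurve (ZMod ℓ)) (_ : V.IsTwoTorsionNF) (_ : V.IsElliptic),
      Nat.card V.toAffine.Point = W.reductionPointCount ℓ ∧
      16 * V.a₄ = ((3 * m ^ 2 + 2 * (integralModelInt W).b₂ * m + 8 * (integralModelInt W).b₄ : ℤ) :
        ZMod ℓ) ∧
      4 * V.a₂ = (((integralModelInt W).b₂ + 3 * m : ℤ) : ZMod ℓ) ∧
      V.Δ = (minimalDiscriminantInt W : ZMod ℓ) := by
  obtain ⟨y, hxy, h2⟩ := hx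
  set M := integralModelInt W with hM
  -- the integer coefficients
  have ha₁ : (M.a₁ : ℚ) = W.a₁ := by
    simpa only [map_a₁, eq_intCast] using congrArg WeierstrassCurve.a₁ (map_integralModelInt W)
  have ha₂ : (M.a₂ : ℚ) = W.a₂ := by
    simpa only [map_a₂, eq_intCast] using congrArg WeierstrassCurve.a₂ (map_integralModelInt W)
  have ha₃ : (M.a₃ : ℚ) = W.a₃ := by
    simpa only [map_a₃, eq_intCast] using congrArg WeierstrassCurve.a₃ (map_integralModelInt W)
  have ha₄ : (M.a₄ : ℚ) = W.a₄ := by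
    simpa only [map_a₄, eq_intCast] using congrArg WeierstrassCurve.a₄ (map_integralModelInt W)
  have ha₆ : (M.a₆ : ℚ) = W.a₆ := by
    simpa only [map_a₆, eq_intCast] using congrArg WeierstrassCurve.a₆ (map_integralModelInt W)
  -- `8y = n ∈ ℤ`
  set n : ℤ := -(M.a₁ * m + 4 * M.a₃) with hn_def
  have hn : (n : ℚ) = 8 * y := by
    rw [hn_def]
    push_cast
    rw [ha₁, ha₃, hm]
    linear_combination -4 * h2
  -- the curve equation as an INTEGER identity
  rw [Affine.equation_iff] at hxy
  have hI : n ^ 2 + 2 * M.a₁ * m * n + 8 * M.a₃ * n = m ^ 3 + 4 * M.a₂ * m ^ 2 + 16 * M.a₄ * m + 64 * M.a₆ := by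
    have h : ((n ^ 2 + 2 * M.a₁ * m * n + 8 * M.a₃ * n : ℤ) : ℚ) =
        ((m ^ 3 + 4 * M.a₂ * m ^ 2 + 16 * M.a₄ * m + 64 * M.a₆ : ℤ) : ℚ) := by
      push_cast
      rw [hn, hm, ha₁, ha₂, ha₃, ha₄, ha₆]
      linear_combination 64 * hxy
    exact_mod_cast h
  have hII : n + M.a₁ * m + 4 * M.a₃ = 0 := by rw [hn_def]; ring
  -- the residue field
  have h2F : (2 : ZMod ℓ) ≠ 0 := by
    intro h
    have h' : ((2 : ℕ) : ZMod ℓ) = 0 := by exact_mod_cast h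
    rw [ZMod.natCast_eq_zero_iff] at h'
    exact hℓ ((Nat.prime_dvd_prime_iff_eq Fact.out Nat.prime_two).mp h')
  have h4F : (4 : ZMod ℓ) ≠ 0 := by rw [show (4 : ZMod ℓ) = 2 ^ 2 by norm_num]; exact pow_ne_zero _ h2F
  have h8F : (8 : ZMod ℓ) ≠ 0 := by rw [show (8 : ZMod ℓ) = 2 ^ 3 by norm_num]; exact pow_ne_zero _ h2F
  have h64F : (64 : ZMod ℓ) ≠ 0 := by rw [show (64 : ZMod ℓ) = 2 ^ 6 by norm_num]; exact pow_ne_zero _ h2F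
  -- the reduced curve is elliptic
  have hΔ : ¬ (ℓ : ℤ) ∣ minimalDiscriminantInt W :=
    not_dvd_minimalDiscriminantInt_of_hasGoodReductionAtPrime' W ℓ hgood
  haveI hE : (reductionModPrime W ℓ).IsElliptic := isElliptic_reductionModPrime W hΔ
  -- the reduced point `(x̃, ỹ) = (m/4, n/8)`
  obtain ⟨xb, hxb⟩ : ∃ xb : ZMod ℓ, (m : ZMod ℓ) = 4 * xb := ⟨(m : ZMod ℓ) / 4, by field_simp⟩
  obtain ⟨yb, hyb⟩ : ∃ yb : ZMod ℓ, (n : ZMod ℓ) = 8 * yb := ⟨(n : ZMod ℓ) / 8, by field_simp⟩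
  have hIF : (8 * yb) ^ 2 + 2 * (M.a₁ : ZMod ℓ) * (4 * xb) * (8 * yb) + 8 * (M.a₃ : ZMod ℓ) * (8 * yb) =
      (4 * xb) ^ 3 + 4 * (M.a₂ : ZMod ℓ) * (4 * xb) ^ 2 + 16 * (M.a₄ : ZMod ℓ) * (4 * xb) +
        64 * (M.a₆ : ZMod ℓ) := by
    have h := congrArg (Int.cast : ℤ → ZMod ℓ) hI
    push_cast at h
    rw [hxb, hyb] at h
    exact h
  have hIIF : 8 * yb + (M.a₁ : ZMod ℓ) * (4 * xb) + 4 * (M.a₃ : ZMod ℓ) = 0 := by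
    have h := congrArg (Int.cast : ℤ → ZMod ℓ) hII
    push_cast at h
    rw [hxb, hyb] at h
    exact h
  have heqE : (reductionModPrime W ℓ).toAffine.Equation xb yb := by
    rw [Affine.equation_iff]
    simp only [reductionModPrime, map_a₁, map_a₂, map_a₃, map_a₄, map_a₆, eq_intCast, ← hM]
    refine mul_left_cancel₀ h64F ?_
    linear_combination hIF
  have h2E : 2 * yb + (M.a₁ : ZMod ℓ) * xb + (M.a₃ : ZMod ℓ) = 0 := by
    refine mul_left_cancel₀ h4F ?_
    linear_combination hIIF
  -- the change of variables to two-torsion normal form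
  let C : VariableChange (ZMod ℓ) := ⟨1, xb, -(M.a₁ : ZMod ℓ) / 2, yb⟩
  let V : WeierstrassCurve (ZMod ℓ) := C • reductionModPrime W ℓ
  have hCu : ((C.u⁻¹ : (ZMod ℓ)ˣ) : ZMod ℓ) = 1 := by simp [C]
  have hV₁ : V.a₁ = 0 := by
    simp only [V, variableChange_a₁, hCu, reductionModPrime, map_a₁, eq_intCast, C]
    field_simp
    ring
  have hV₃ : V.a₃ = 0 := by
    simp only [V, variableChange_a₃, hCu, reductionModPrime, map_a₁, map_a₃, eq_intCast, C]
    linear_combination h2E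
  have hV₆ : V.a₆ = 0 := by
    rw [Affine.equation_iff] at heqE
    simp only [reductionModPrime, map_a₁, map_a₂, map_a₃, map_a₄, map_a₆, eq_intCast] at heqE
    simp only [V, variableChange_a₆, hCu, reductionModPrime, map_a₁, map_a₂, map_a₃, map_a₄, map_a₆,
      eq_intCast, C]
    linear_combination -heqE
  haveI hNF : V.IsTwoTorsionNF := ⟨hV₁, hV₃, hV₆⟩
  haveI hVE : V.IsElliptic := inferInstance
  refine ⟨V, hNF, hVE, ?_, ?_, ?_, ?_⟩
  · -- point count
    rw [reductionPointCount_eq_natCard_point]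
    exact natCard_point_smul C _
  · -- `16 b = 3m² + 2b₂m + 8b₄`
    simp only [V, variableChange_a₄, hCu, reductionModPrime, map_a₁, map_a₂, map_a₃, map_a₄,
      eq_intCast, C, WeierstrassCurve.b₂, WeierstrassCurve.b₄]
    push_cast
    rw [hxb]
    field_simp
    ring
  · -- `4 a = b₂ + 3m`
    simp only [V, variableChange_a₂, hCu, reductionModPrime, map_a₁, map_a₂, eq_intCast, C,
      WeierstrassCurve.b₂]
    push_cast
    rw [hxb]
    field_simp
    ring
  · -- `Δ(V) = Δ_W`
    simp only [V, variableChange_Δ, hCu, one_pow, one_mul, reductionModPrime, map_Δ, eq_intCast,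
      minimalDiscriminantInt]
end Transport

/-! ## §2. K0 `ModFourTraceOfOneTwoTorsionPoint`: the mod-`4` trace from ONE rational point of order `2` -/

section Main
variable (W : WeierstrassCurve ℚ) [W.IsElliptic] [W.IsGloballyMinimal] (ℓ : ℕ) [Fact ℓ.Prime]

omit [W.IsElliptic] in
/-- **K0, point-count form.** Let `W/ℚ` be globally minimal with a rational point `P = (x, y)` of
order `2`, `m = 4x ∈ ℤ`, `b₂, b₄ ∈ ℤ` the invariants of the minimal model, and `ℓ` an odd prime of good
reduction. Put `B = 3m² + 2b₂m + 8b₄` (`= 16·(3x² + (b₂/2)x + b₄/2)`, the square class of the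
discriminant of the `2`-isogenous curve `E/⟨P⟩`) and let `Δ` be the minimal discriminant (square
class of `d = A² - 4B`, `ℚ(√d) = ℚ(E[2])`). Then **`4 ∣ #W̃(𝔽_ℓ)` iff `B` is a square mod `ℓ` or `Δ`
is a square mod `ℓ`** — i.e. iff `W̃(𝔽_ℓ)` has a point `Q` with `2Q = P̃` (`x(Q)² = B/16`) or full
`2`-torsion. Knapp, *Elliptic Curves*, Thm. 4.2; Silverman, *AEC*, X.4.9. [cite: Knapp1993, Thm. 4.2]
[cite: SilvermanAEC2009, X.4.9] -/
theorem four_dvd_reductionPointCount_iff_of_hasRationalTwoTorsionX (hℓ : ℓ ≠ 2)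
    (hgood : W.HasGoodReductionAtPrime ℓ) {x : ℚ} (hx : HasRationalTwoTorsionX W x) {m : ℤ}
    (hm : (m : ℚ) = 4 * x) :
    4 ∣ W.reductionPointCount ℓ ↔
      IsSquare (((3 * m ^ 2 + 2 * (integralModelInt W).b₂ * m + 8 * (integralModelInt W).b₄ : ℤ) :
          ZMod ℓ)) ∨
        IsSquare ((minimalDiscriminantInt W : ZMod ℓ)) := by
  obtain ⟨V, hNF, hVE, hcard, hb, -, hΔ⟩ := exists_twoTorsionNF_reduction W ℓ hℓ hgood hx hm
  have h4 : (4 : ZMod ℓ) ≠ 0 := by rw [show (4 : ZMod ℓ) = 2 ^ 2 by norm_num]; exact pow_ne_zero _ (two_ne_zero' V)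
  rw [← hcard, four_dvd_natCard_point_iff_isSquare V, ← hb, hΔ.symm, Δ_of_isTwoTorsionNF,
    show (16 : ZMod ℓ) * V.a₄ = 4 ^ 2 * V.a₄ by norm_num,
    show (16 : ZMod ℓ) * V.a₄ ^ 2 * (V.a₂ ^ 2 - 4 * V.a₄) = (4 * V.a₄) ^ 2 * (V.a₂ ^ 2 - 4 * V.a₄) by
      ring,
    isSquare_sq_mul_iff (mul_ne_zero h4 (a₄_ne_zero V)), isSquare_sq_mul_iff h4]

omit [W.IsElliptic] in
/-- **K0 `ModFourTraceOfOneTwoTorsionPoint`, trace form: `a_ℓ ≡ ℓ + 1 (mod 4)` iff `(B/ℓ) = 1` or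
`(Δ/ℓ) = 1`** for a globally minimal `W/ℚ` with ONE rational point of order `2` (abscissa `x`,
`m = 4x`), at every odd prime `ℓ` of good reduction (`a_ℓ = frobeniusTrace W ℓ = ℓ + 1 - #W̃(𝔽_ℓ)`).
Equivalently, the Rédei-type congruence **`a_ℓ ≡ ℓ + 1 - 2·e_B(ℓ)·e_Δ(ℓ) (mod 4)`** with
`e_c(ℓ) = [c is a non-square mod ℓ]`: it STRICTLY REFINES the mod-`4` Eisenstein congruence
`eisensteinCongruenceModFour` of the full-`2`-torsion case (`Δ` a square). This is the first lemma K0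
of the crux idea `mod-four-redei-layer-two` on item 19556 `OrdLambdaHalfAtTwo` (salvaged by the pen,
PEN-PICK-19556-r1 §1(c), as a lemma toward the analytic stub of line `gv-mixed-descent-two`), verified
numerically by its author on 10 602 (curve, `ℓ`) pairs. [cite: Knapp1993, Thm. 4.2]
[cite: SilvermanAEC2009, X.4.9 and V.2.3.1] -/
theorem four_dvd_succ_sub_frobeniusTrace_iff_of_hasRationalTwoTorsionX (hℓ : ℓ ≠ 2)
    (hgood : W.HasGoodReductionAtPrime ℓ) {x : ℚ} (hx : HasRationalTwoTorsionX W x) {m : ℤ}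
    (hm : (m : ℚ) = 4 * x) :
    (4 : ℤ) ∣ (ℓ : ℤ) + 1 - W.frobeniusTrace ℓ ↔
      IsSquare (((3 * m ^ 2 + 2 * (integralModelInt W).b₂ * m + 8 * (integralModelInt W).b₄ : ℤ) :
          ZMod ℓ)) ∨
        IsSquare ((minimalDiscriminantInt W : ZMod ℓ)) := by
  rw [← four_dvd_reductionPointCount_iff_of_hasRationalTwoTorsionX W ℓ hℓ hgood hx hm,
    WeierstrassCurve.frobeniusTrace, sub_sub_cancel]
  exact Int.natCast_dvd_natCast

/-- **The doubly-inert case: `a_ℓ ≡ ℓ - 1 (mod 4)`** when neither `B` nor `Δ` is a square mod `ℓ`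
(`a_ℓ` is even by the mod-`2` congruence `even_frobeniusTrace_of_hasRationalTwoTorsionX`, and
`4 ∤ ℓ + 1 - a_ℓ`). [cite: Knapp1993, Thm. 4.2] [cite: SilvermanAEC2009, V.2.3.1] -/
theorem four_dvd_pred_sub_frobeniusTrace_of_not_isSquare (hℓ : ℓ ≠ 2)
    (hgood : W.HasGoodReductionAtPrime ℓ) {x : ℚ} (hx : HasRationalTwoTorsionX W x) {m : ℤ}
    (hm : (m : ℚ) = 4 * x)
    (hB : ¬ IsSquare (((3 * m ^ 2 + 2 * (integralModelInt W).b₂ * m + 8 * (integralModelInt W).b₄ :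
      ℤ) : ZMod ℓ)))
    (hΔ : ¬ IsSquare ((minimalDiscriminantInt W : ZMod ℓ))) :
    (4 : ℤ) ∣ (ℓ : ℤ) - 1 - W.frobeniusTrace ℓ := by
  have h4 : ¬ (4 : ℤ) ∣ (ℓ : ℤ) + 1 - W.frobeniusTrace ℓ := by
    rw [four_dvd_succ_sub_frobeniusTrace_iff_of_hasRationalTwoTorsionX W ℓ hℓ hgood hx hm]
    push Not
    exact ⟨hB, hΔ⟩
  obtain ⟨a, ha⟩ := even_frobeniusTrace_of_hasRationalTwoTorsionX W ℓ hℓ hgood hx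
  obtain ⟨k, hk⟩ := (Fact.out : ℓ.Prime).odd_of_ne_two hℓ
  have hℓ' : (ℓ : ℤ) = 2 * k + 1 := by exact_mod_cast hk
  rw [ha, hℓ'] at h4 ⊢
  -- `ℓ + 1 - a_ℓ = 2(k + 1 - a)` is not divisible by `4`, so `k + 1 - a` is odd and `ℓ - 1 - a_ℓ = 2(k - a)` is
  have hodd : ¬ (2 : ℤ) ∣ (k : ℤ) + 1 - a := by
    intro ⟨j, hj⟩
    exact h4 ⟨j, by linear_combination 2 * hj⟩
  obtain ⟨j, hj⟩ := Int.even_or_odd' ((k : ℤ) + 1 - a)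
  rcases hj with hj | hj
  · exact absurd ⟨j, by rw [hj]⟩ hodd
  · exact ⟨j, by linear_combination 2 * hj⟩

omit [W.IsElliptic] in
/-- **K0 in the card's rational currency** (`Ideas/mod-four-redei-layer-two.md`, First lemma): with
`B' = 3x² + (b₂/2)x + b₄/2` and `d' = (3x + b₂/4)² - 4B'` the coefficients of the centred model
`y² = X(X² + A'X + B')`, and INTEGER representatives `Bz`, `dz` of their rational square classes prime
to `ℓ`: `4 ∣ ℓ + 1 - a_ℓ ↔ (Bz/ℓ) = 1 ∨ (dz/ℓ) = 1`. (`16B' = B`, `16²B'²·16d' = Δ_W`, so the square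
classes agree with those of the integer form.) [cite: Knapp1993, Thm. 4.2] [cite: SilvermanAEC2009, X.4.9] -/
theorem modFourTraceOfOneTwoTorsionPoint [W.IsElliptic] (hℓ : ℓ ≠ 2)
    (hgood : W.HasGoodReductionAtPrime ℓ) {x : ℚ} (hx : HasRationalTwoTorsionX W x) (Bz dz : ℤ)
    (hBℓ : ¬ (ℓ : ℤ) ∣ Bz) (hdℓ : ¬ (ℓ : ℤ) ∣ dz)
    (hB : IsSquare ((Bz : ℚ) * (3 * x ^ 2 + W.b₂ / 2 * x + W.b₄ / 2)))
    (hd : IsSquare ((dz : ℚ) * ((3 * x + W.b₂ / 4) ^ 2 - 4 * (3 * x ^ 2 + W.b₂ / 2 * x + W.b₄ / 2)))) :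
    (4 : ℤ) ∣ (ℓ : ℤ) + 1 - W.frobeniusTrace ℓ ↔ IsSquare (Bz : ZMod ℓ) ∨ IsSquare (dz : ZMod ℓ) := by
  obtain ⟨m, hm⟩ := exists_int_eq_four_mul_of_hasRationalTwoTorsionX W hx
  obtain ⟨V, hNF, hVE, hcard, hb, ha, -⟩ := exists_twoTorsionNF_reduction W ℓ hℓ hgood hx hm
  have hb₂ : ((integralModelInt W).b₂ : ℚ) = W.b₂ := by
    simpa only [map_b₂, eq_intCast] using congrArg WeierstrassCurve.b₂ (map_integralModelInt W)
  have hb₄ : ((integralModelInt W).b₄ : ℚ) = W.b₄ := by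
    simpa only [map_b₄, eq_intCast] using congrArg WeierstrassCurve.b₄ (map_integralModelInt W)
  -- the integer forms `B = 16 B'`, `D = 16 d'` are integer squares times `Bz`, `dz`
  have hBsq : IsSquare (Bz * (3 * m ^ 2 + 2 * (integralModelInt W).b₂ * m + 8 * (integralModelInt W).b₄)) := by
    rw [← Rat.isSquare_intCast_iff]
    obtain ⟨q, hq⟩ := hB
    refine ⟨4 * q, ?_⟩
    push_cast
    rw [hb₂, hb₄, hm]
    linear_combination 16 * hq
  have hdsq : IsSquare (dz * (((integralModelInt W).b₂ + 3 * m) ^ 2 -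
      4 * (3 * m ^ 2 + 2 * (integralModelInt W).b₂ * m + 8 * (integralModelInt W).b₄))) := by
    rw [← Rat.isSquare_intCast_iff]
    obtain ⟨q, hq⟩ := hd
    refine ⟨4 * q, ?_⟩
    push_cast
    rw [hb₂, hb₄, hm]
    linear_combination 16 * hq
  -- in the residue field
  have h4 : (4 : ZMod ℓ) ≠ 0 := by rw [show (4 : ZMod ℓ) = 2 ^ 2 by norm_num]; exact pow_ne_zero _ (two_ne_zero' V)
  have hb' : ((3 * m ^ 2 + 2 * (integralModelInt W).b₂ * m + 8 * (integralModelInt W).b₄ : ℤ) : ZMod ℓ) =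
      4 ^ 2 * V.a₄ := by rw [← hb]; norm_num
  have hd' : ((((integralModelInt W).b₂ + 3 * m) ^ 2 -
      4 * (3 * m ^ 2 + 2 * (integralModelInt W).b₂ * m + 8 * (integralModelInt W).b₄) : ℤ) : ZMod ℓ) =
      4 ^ 2 * (V.a₂ ^ 2 - 4 * V.a₄) := by
    push_cast at hb ha ⊢
    linear_combination -(((integralModelInt W).b₂ : ZMod ℓ) + 3 * (m : ZMod ℓ) + 4 * V.a₂) * ha + 4 * hb
  have hBz0 : (Bz : ZMod ℓ) ≠ 0 := by rwa [Ne, ZMod.intCast_zmod_eq_zero_iff_dvd]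
  have hdz0 : (dz : ZMod ℓ) ≠ 0 := by rwa [Ne, ZMod.intCast_zmod_eq_zero_iff_dvd]
  have hBi0 : (4 : ZMod ℓ) ^ 2 * V.a₄ ≠ 0 := mul_ne_zero (pow_ne_zero _ h4) (a₄_ne_zero V)
  have hdi0 : (4 : ZMod ℓ) ^ 2 * (V.a₂ ^ 2 - 4 * V.a₄) ≠ 0 :=
    mul_ne_zero (pow_ne_zero _ h4) (a₂_sq_sub_ne_zero V)
  obtain ⟨k, hk⟩ := hBsq
  obtain ⟨k', hk'⟩ := hdsq
  have e₁ : IsSquare (Bz : ZMod ℓ) ↔ IsSquare ((4 : ZMod ℓ) ^ 2 * V.a₄) := by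
    refine isSquare_iff_of_mul_eq_sq hBz0 hBi0 (k := (k : ZMod ℓ)) ?_
    rw [← hb']
    have h := congrArg (Int.cast : ℤ → ZMod ℓ) hk
    push_cast at h ⊢
    linear_combination h
  have e₂ : IsSquare (dz : ZMod ℓ) ↔ IsSquare ((4 : ZMod ℓ) ^ 2 * (V.a₂ ^ 2 - 4 * V.a₄)) := by
    refine isSquare_iff_of_mul_eq_sq hdz0 hdi0 (k := (k' : ZMod ℓ)) ?_
    rw [← hd']
    have h := congrArg (Int.cast : ℤ → ZMod ℓ) hk'
    push_cast at h ⊢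
    linear_combination h
  rw [WeierstrassCurve.frobeniusTrace, sub_sub_cancel,
    show ((4 : ℤ) ∣ (W.reductionPointCount ℓ : ℤ)) ↔ 4 ∣ W.reductionPointCount ℓ from Int.natCast_dvd_natCast,
    ← hcard, four_dvd_natCard_point_iff_isSquare V, e₁, e₂, isSquare_sq_mul_iff h4,
    isSquare_sq_mul_iff h4]
end Main

/-! ## §3. Canonical form on a `ℤ/2`-linked pair: `4 ∣ #Ẽ(𝔽_ℓ)` iff `Δ_E` or `Δ_{E'}` is a square mod `ℓ` -/

section Pair
variable {W W' : WeierstrassCurve ℚ} [W.IsElliptic] [W.IsGloballyMinimal] [W'.IsElliptic]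
  [W'.IsGloballyMinimal] {C C' : VariableChange ℚ}

/-- **K0 on a `ℤ/2`-linked pair (canonical square classes).** Let `W`, `W'` be globally minimal
models linked by the explicit `2`-isogeny (`C • W` a two-torsion normal form of `W` with kernel
generator `P = (C.r, C.t)`, `C' • W' = (C • W).twoIsogenyCodomain`, i.e. `E' = E/⟨P⟩`), and `ℓ` an
odd prime of good reduction. Then **`a_ℓ(E) ≡ ℓ + 1 (mod 4)` iff `Δ_{E'}` is a square mod `ℓ` or
`Δ_E` is a square mod `ℓ`**: the two square classes of K0 are those of the minimal discriminants of
the pair (`B ∼ Δ(E') = 256·b·(a² - 4b)²`, `d ∼ Δ(E) = 16·b²·(a² - 4b)`). Symmetric in `E ↔ E'`, as it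
must be (`a_ℓ(E) = a_ℓ(E')`). [cite: Knapp1993, Thm. 4.2] [cite: SilvermanAEC2009, III.4 Example 4.5 and X.4.9] -/
theorem four_dvd_succ_sub_frobeniusTrace_iff_of_twoTorsionPair [(C • W).IsTwoTorsionNF]
    (hlink : C' • W' = (C • W).twoIsogenyCodomain) (ℓ : ℕ) [Fact ℓ.Prime] (hℓ : ℓ ≠ 2)
    (hgood : W.HasGoodReductionAtPrime ℓ) :
    (4 : ℤ) ∣ (ℓ : ℤ) + 1 - W.frobeniusTrace ℓ ↔
      IsSquare ((minimalDiscriminantInt W' : ZMod ℓ)) ∨ IsSquare ((minimalDiscriminantInt W : ZMod ℓ)) := by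
  have hiso := TwoAdicOffHabitat.isIsogenous_of_twoTorsionPair hlink
  have hgood' : W'.HasGoodReductionAtPrime ℓ := (hiso.hasGoodReductionAtPrime_iff ℓ).mp hgood
  have hx : HasRationalTwoTorsionX W C.r := hasRationalTwoTorsionX_of_isTwoTorsionNF_smul W C
  haveI : (C' • W').IsTwoTorsionNF := by rw [hlink]; infer_instance
  -- the normal-form coefficients `b = a₄(C • W)`, `a = a₂(C • W)` against `B'`, `A'`
  set v : ℚ := ((C.u⁻¹ : ℚˣ) : ℚ) with hv
  set v' : ℚ := ((C'.u⁻¹ : ℚˣ) : ℚ) with hv'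
  have hv0 : v ≠ 0 := Units.ne_zero _
  have hv'0 : v' ≠ 0 := Units.ne_zero _
  have ha₂ := four_mul_a₂_of_isTwoTorsionNF_smul W C
  have ha₄ := two_mul_a₄_of_isTwoTorsionNF_smul W C
  rw [← hv] at ha₂ ha₄
  have hB' : 3 * C.r ^ 2 + W.b₂ / 2 * C.r + W.b₄ / 2 = (C • W).a₄ / v ^ 4 := by
    field_simp
    linear_combination -ha₄
  have hd' : (3 * C.r + W.b₂ / 4) ^ 2 - 4 * (3 * C.r ^ 2 + W.b₂ / 2 * C.r + W.b₄ / 2) =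
      ((C • W).a₂ ^ 2 - 4 * (C • W).a₄) / v ^ 4 := by
    have hA' : 3 * C.r + W.b₂ / 4 = (C • W).a₂ / v ^ 2 := by
      field_simp
      linear_combination -ha₂
    rw [hB', hA']
    field_simp
  -- the discriminants
  have hΔ : (minimalDiscriminantInt W : ℚ) = 16 * (C • W).a₄ ^ 2 * ((C • W).a₂ ^ 2 - 4 * (C • W).a₄) / v ^ 12 := by
    rw [cast_minimalDiscriminantInt, ← Δ_of_isTwoTorsionNF, variableChange_Δ, ← hv]
    field_simp
  have hΔ' : (minimalDiscriminantInt W' : ℚ) =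
      256 * (C • W).a₄ * ((C • W).a₂ ^ 2 - 4 * (C • W).a₄) ^ 2 / v' ^ 12 := by
    rw [cast_minimalDiscriminantInt, ← twoIsogenyCodomain_Δ, ← hlink, variableChange_Δ, ← hv']
    field_simp
  refine modFourTraceOfOneTwoTorsionPoint W ℓ hℓ hgood hx (minimalDiscriminantInt W')
    (minimalDiscriminantInt W) (not_dvd_minimalDiscriminantInt_of_hasGoodReductionAtPrime' W' ℓ hgood')
    (not_dvd_minimalDiscriminantInt_of_hasGoodReductionAtPrime' W ℓ hgood) ?_ ?_
  · rw [hB', hΔ']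
    exact ⟨16 * (C • W).a₄ * ((C • W).a₂ ^ 2 - 4 * (C • W).a₄) / (v' ^ 6 * v ^ 2), by
      field_simp; ring⟩
  · rw [hd', hΔ]
    exact ⟨4 * (C • W).a₄ * ((C • W).a₂ ^ 2 - 4 * (C • W).a₄) / v ^ 8, by field_simp; ring⟩
end Pair







end Summit.BirchSwinnertonDyer.BirchSwinnertonDyer.Theorems.TwoAdicTwistConverse

end
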